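import Summits.RiemannHypothesis.RiemannHypothesis.Theorems.HandoffDodgerCostTheorem
import Summits.RiemannHypothesis.RiemannHypothesis.Theorems.HandoffDodgerFarTailSharp
import HarnessLib

/-!
# HANDOFF — the COST SUM and COST THEOREM of the dodger with the SHARP far tail (rh-explicit, track «HANDOFF», seat prove-2 gen14, ATTEMPT-24 §2, brick FT part 6)

HONEST FRAMING. Nothing here bears on the truth of RH; RH-free upper-side bookkeeping. These are the tree's
`HandoffDodgerCostSum.cost_sum_le` and `HandoffDodgerCostTheorem.dodger_cost_le` VERBATIM except that the far-zone bracket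
`N(√(c/4))/(e·c/4) + B(0, √(c/4))` (unit-window counting, `≈ (55·log c + 220)·2/√c`) is replaced by the Stieltjes form of
`HandoffDodgerFarTailSharp.far_cost_le_sharp`, `(0.1615·log √(c/4) − 0.11)/√(c/4)`, under `c ≥ 4e¹⁶` (instead of `c ≥ 64`):

* `cost_sum_le_ft` — `Σ_ρ m·(A/γ²·e^{4S(γ)}·e^{−c/(γ+1)²}) ≤ A·[N(2T)/T²·e^{4Sₙ − c/(2T+1)²} + e^{144p²/(7c)}·(0.1615·log √(c/4) − 0.11)/√(c/4)]`;
* `dodger_cost_le_ft` — the `∀ U, Σᶠ m‖Ĝ‖² ≤ B` clause for the mollified dodger with this bracket;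
* `farBracket_pos`, `farBracket_anti` — the bracket is positive for `c ≥ 4e¹⁶` and non-increasing in `√(c/4) ≥ e²`.
The witness, the near zone, the AM–GM step and every other constant are unchanged. No `sorry`, standard axioms, no definitions.

References: this track (ATTEMPT-16 §4 Lemmas C3/C4; ATTEMPT-18 (D-4); ATTEMPT-24 §1–§2).
-/

set_option linter.dupNamespace false

noncomputable section

open Complex Finset MeasureTheory Real
open scoped ComplexConjugate

namespace Summit.RiemannHypothesis.RiemannHypothesis.Theorems.Handoff

open Literature.NumberTheory.LFunctions Literature.NumberTheory.LFunctions.SchoenfeldBound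
  Literature.NumberTheory.LFunctions.KadiriTail Literature.NumberTheory.LFunctions.WeilContinuous

/-- The sharp far bracket is positive for `c ≥ 4e¹⁶` (`log √(c/4) ≥ 8`). [this track, ATTEMPT-24 §1] -/
theorem farBracket_pos {c : ℝ} (hc : 4 * Real.exp 16 ≤ c) :
    0 < (0.1615 * Real.log (Real.sqrt (c / 4)) - 0.11) / Real.sqrt (c / 4) := by
  have ha : Real.exp 16 ≤ c / 4 := by linarith
  have h16 : Real.exp 16 = Real.exp 8 ^ 2 := by rw [← Real.exp_nat_mul]; norm_num
  have hX8 : Real.exp 8 ≤ Real.sqrt (c / 4) := by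
    have h := Real.sqrt_le_sqrt ha
    rwa [h16, Real.sqrt_sq (Real.exp_pos 8).le] at h
  have hX0 : 0 < Real.sqrt (c / 4) := lt_of_lt_of_le (Real.exp_pos 8) hX8
  have hℓ : 8 ≤ Real.log (Real.sqrt (c / 4)) := by rw [Real.le_log_iff_exp_le hX0]; exact hX8
  exact div_pos (by linarith) hX0

/-- `(0.1615·log x − 0.11)/x` is non-increasing for `x ≥ e²`: with `κ = 220/323` (`0.1615κ = 0.11`) it equals
`0.1615·(log u + κ − κ)…`; precisely `(log t − κ)/t = e^{−κ}·log u/u`, `u = t/e^κ ≥ e`, and `log u/u` is non-increasing on `[e, ∞)`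
(`Real.log_div_self_antitoneOn`). [folklore] -/
theorem farBracket_anti {x y : ℝ} (hx : Real.exp 2 ≤ x) (hxy : x ≤ y) :
    (0.1615 * Real.log y - 0.11) / y ≤ (0.1615 * Real.log x - 0.11) / x := by
  have hκ : (0 : ℝ) < Real.exp (220 / 323) := Real.exp_pos _
  have hx0 : 0 < x := lt_of_lt_of_le (Real.exp_pos 2) hx
  have hy0 : 0 < y := lt_of_lt_of_le hx0 hxy
  have hu : Real.exp 1 ≤ x / Real.exp (220 / 323) := by
    rw [le_div_iff₀ hκ, ← Real.exp_add]
    exact (Real.exp_le_exp.2 (by norm_num)).trans hx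
  have hv : Real.exp 1 ≤ y / Real.exp (220 / 323) := hu.trans (div_le_div_of_nonneg_right hxy hκ.le)
  have h := Real.log_div_self_antitoneOn hu hv (div_le_div_of_nonneg_right hxy hκ.le)
  dsimp only at h
  -- `log(t/e^κ)/(t/e^κ) = e^κ·(log t − κ)/t`
  have e : ∀ t : ℝ, 0 < t → Real.log (t / Real.exp (220 / 323)) / (t / Real.exp (220 / 323)) =
      Real.exp (220 / 323) * ((Real.log t - 220 / 323) / t) := by
    intro t ht
    rw [Real.log_div ht.ne' hκ.ne', Real.log_exp]
    field_simp
  rw [e x hx0, e y hy0] at h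
  have h2 := le_of_mul_le_mul_left h hκ
  have ex : (0.1615 * Real.log x - 0.11) / x = 0.1615 * ((Real.log x - 220 / 323) / x) := by
    rw [mul_div_assoc']; congr 1; ring
  have ey : (0.1615 * Real.log y - 0.11) / y = 0.1615 * ((Real.log y - 220 / 323) / y) := by
    rw [mul_div_assoc']; congr 1; ring
  rw [ex, ey]
  exact mul_le_mul_of_nonneg_left h2 (by norm_num)

/-- **The cost sum with the sharp far tail.** See the module docstring. [this track, ATTEMPT-16 Lemmas C3/C4; ATTEMPT-18 (D-4); ATTEMPT-24 §2] -/
theorem cost_sum_le_ft {T c A p Sn : ℝ} (hT : 2 ≤ T) (hc : 4 * Real.exp 16 ≤ c) (hA : 0 ≤ A)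
    {S : ℝ → ℝ} (hSn : ∀ γ : ℝ, T < γ → γ ≤ 2 * T → S γ ≤ Sn) (hSf : ∀ γ : ℝ, 2 * T < γ → S γ ≤ p / γ)
    (s : Finset ℂ) (hs : ∀ ρ ∈ s, riemannZeta ρ = 0 ∧ 0 ≤ ρ.re ∧ ρ.re ≤ 1 ∧ T < ρ.im) :
    ∑ ρ ∈ s, (riemannZetaZeroOrder ρ : ℝ) * (A / ρ.im ^ 2 * Real.exp (4 * S ρ.im) * Real.exp (-c / (ρ.im + 1) ^ 2)) ≤
      A * ((zetaZeroCount (2 * T) : ℝ) / T ^ 2 * Real.exp (4 * Sn - c / (2 * T + 1) ^ 2) +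
        Real.exp (144 * p ^ 2 / (7 * c)) *
          ((0.1615 * Real.log (Real.sqrt (c / 4)) - 0.11) / Real.sqrt (c / 4))) := by
  classical
  have hc64 : 64 ≤ c := by
    have : (16 : ℝ) ≤ Real.exp 16 := by linarith [Real.add_one_le_exp (16 : ℝ)]
    linarith
  have hc0 : 0 < c := by linarith
  have hT0 : 0 < T := by linarith
  have hm0 : ∀ ρ ∈ s, (0 : ℝ) ≤ riemannZetaZeroOrder ρ := fun ρ hρ ↦ by
    obtain ⟨hz, -, -, him⟩ := hs ρ hρ
    exact_mod_cast zero_le_one.trans (ZetaZeros.riemannZetaNontrivialZeros.one_le_order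
      (ZetaZeros.riemannZetaNontrivialZeros.mem_of_im_ne_zero hz (by linarith : ρ.im ≠ 0)))
  set s₁ : Finset ℂ := s.filter (fun ρ ↦ ρ.im ≤ 2 * T) with hs₁
  set s₂ : Finset ℂ := s.filter (fun ρ ↦ ¬ ρ.im ≤ 2 * T) with hs₂
  rw [← sum_filter_add_sum_filter_not s (fun ρ ↦ ρ.im ≤ 2 * T), mul_add]
  refine add_le_add ?_ ?_
  · -- NEAR: `T < γ ≤ 2T` (verbatim from `cost_sum_le`)
    have hterm : ∀ ρ ∈ s₁, (riemannZetaZeroOrder ρ : ℝ) * (A / ρ.im ^ 2 * Real.exp (4 * S ρ.im) * Real.exp (-c / (ρ.im + 1) ^ 2)) ≤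
        (riemannZetaZeroOrder ρ : ℝ) * (A / T ^ 2 * Real.exp (4 * Sn - c / (2 * T + 1) ^ 2)) := by
      intro ρ hρ
      obtain ⟨hρs, hle⟩ := mem_filter.1 hρ
      obtain ⟨-, -, -, hγ⟩ := hs ρ hρs
      refine mul_le_mul_of_nonneg_left ?_ (hm0 ρ hρs)
      have h1 : A / ρ.im ^ 2 ≤ A / T ^ 2 :=
        div_le_div_of_nonneg_left hA (by positivity) (pow_le_pow_left₀ hT0.le hγ.le 2)
      have h2 : Real.exp (4 * S ρ.im) * Real.exp (-c / (ρ.im + 1) ^ 2) ≤ Real.exp (4 * Sn - c / (2 * T + 1) ^ 2) := by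
        rw [← Real.exp_add]
        refine Real.exp_le_exp.2 ?_
        have h3 := hSn ρ.im hγ hle
        have hγ1 : 0 < ρ.im + 1 := by linarith
        have h4 : c / (2 * T + 1) ^ 2 ≤ c / (ρ.im + 1) ^ 2 :=
          div_le_div_of_nonneg_left hc0.le (pow_pos hγ1 2) (pow_le_pow_left₀ hγ1.le (by linarith) 2)
        rw [neg_div]
        linarith
      calc A / ρ.im ^ 2 * Real.exp (4 * S ρ.im) * Real.exp (-c / (ρ.im + 1) ^ 2)
          = A / ρ.im ^ 2 * (Real.exp (4 * S ρ.im) * Real.exp (-c / (ρ.im + 1) ^ 2)) := by ring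
        _ ≤ A / T ^ 2 * Real.exp (4 * Sn - c / (2 * T + 1) ^ 2) :=
            mul_le_mul h1 h2 (by positivity) (by positivity)
    refine (sum_le_sum hterm).trans ?_
    rw [← sum_mul]
    have hcount : ∑ ρ ∈ s₁, (riemannZetaZeroOrder ρ : ℝ) ≤ zetaZeroCount (2 * T) :=
      sum_zeroOrder_le_zetaZeroCount (by linarith) s₁ fun ρ hρ ↦ by
        obtain ⟨hρs, hle⟩ := mem_filter.1 hρ
        obtain ⟨hz, h1, h2, hγ⟩ := hs ρ hρs
        exact ⟨hz, h1, h2, by linarith, hle⟩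
    have : (∑ ρ ∈ s₁, (riemannZetaZeroOrder ρ : ℝ)) * (A / T ^ 2 * Real.exp (4 * Sn - c / (2 * T + 1) ^ 2)) ≤
        (zetaZeroCount (2 * T) : ℝ) * (A / T ^ 2 * Real.exp (4 * Sn - c / (2 * T + 1) ^ 2)) :=
      mul_le_mul_of_nonneg_right hcount (by positivity)
    refine this.trans (le_of_eq ?_)
    ring
  · -- FAR: `γ > 2T`, AM–GM as in `cost_sum_le`, then the SHARP far tail
    have ha16 : Real.exp 16 ≤ c / 4 := by linarith
    have hterm : ∀ ρ ∈ s₂, (riemannZetaZeroOrder ρ : ℝ) * (A / ρ.im ^ 2 * Real.exp (4 * S ρ.im) * Real.exp (-c / (ρ.im + 1) ^ 2)) ≤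
        A * Real.exp (144 * p ^ 2 / (7 * c)) *
          ((riemannZetaZeroOrder ρ : ℝ) * (Real.exp (-(c / 4) / ρ.im ^ 2) / ρ.im ^ 2)) := by
      intro ρ hρ
      obtain ⟨hρs, hgt⟩ := mem_filter.1 hρ
      have hγ2T : 2 * T < ρ.im := lt_of_not_ge hgt
      have hγ2 : 2 ≤ ρ.im := by linarith
      have hγ0 : 0 < ρ.im := by linarith
      have hexp : Real.exp (4 * S ρ.im) * Real.exp (-c / (ρ.im + 1) ^ 2) ≤
          Real.exp (144 * p ^ 2 / (7 * c)) * Real.exp (-(c / 4) / ρ.im ^ 2) := by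
        rw [← Real.exp_add, ← Real.exp_add]
        refine Real.exp_le_exp.2 ?_
        have h1 : 4 * S ρ.im ≤ 4 * p / ρ.im := by
          have := hSf ρ.im hγ2T
          rw [mul_div_assoc]
          linarith
        have h2 := far_exponent_le (p := p) hγ2 hc0
        rw [neg_div, neg_div]
        linarith
      have e : (riemannZetaZeroOrder ρ : ℝ) * (A / ρ.im ^ 2 * Real.exp (4 * S ρ.im) * Real.exp (-c / (ρ.im + 1) ^ 2)) =
          (riemannZetaZeroOrder ρ : ℝ) * (A / ρ.im ^ 2) * (Real.exp (4 * S ρ.im) * Real.exp (-c / (ρ.im + 1) ^ 2)) := by ring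
      rw [e]
      calc (riemannZetaZeroOrder ρ : ℝ) * (A / ρ.im ^ 2) * (Real.exp (4 * S ρ.im) * Real.exp (-c / (ρ.im + 1) ^ 2))
          ≤ (riemannZetaZeroOrder ρ : ℝ) * (A / ρ.im ^ 2) * (Real.exp (144 * p ^ 2 / (7 * c)) * Real.exp (-(c / 4) / ρ.im ^ 2)) :=
            mul_le_mul_of_nonneg_left hexp (mul_nonneg (hm0 ρ hρs) (by positivity))
        _ = A * Real.exp (144 * p ^ 2 / (7 * c)) *
              ((riemannZetaZeroOrder ρ : ℝ) * (Real.exp (-(c / 4) / ρ.im ^ 2) / ρ.im ^ 2)) := by ring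
    refine (sum_le_sum hterm).trans ?_
    rw [← mul_sum]
    have hfar := far_cost_le_sharp ha16 s₂ fun ρ hρ ↦ by
      obtain ⟨hρs, hgt⟩ := mem_filter.1 hρ
      obtain ⟨hz, h1, h2, hγ⟩ := hs ρ hρs
      exact ⟨hz, h1, h2, by linarith⟩
    have hAE : 0 ≤ A * Real.exp (144 * p ^ 2 / (7 * c)) := mul_nonneg hA (Real.exp_pos _).le
    calc A * Real.exp (144 * p ^ 2 / (7 * c)) *
          ∑ ρ ∈ s₂, (riemannZetaZeroOrder ρ : ℝ) * (Real.exp (-(c / 4) / ρ.im ^ 2) / ρ.im ^ 2)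
        ≤ A * Real.exp (144 * p ^ 2 / (7 * c)) *
          ((0.1615 * Real.log (Real.sqrt (c / 4)) - 0.11) / Real.sqrt (c / 4)) :=
          mul_le_mul_of_nonneg_left hfar hAE
      _ = A * (Real.exp (144 * p ^ 2 / (7 * c)) *
          ((0.1615 * Real.log (Real.sqrt (c / 4)) - 0.11) / Real.sqrt (c / 4))) := by ring

/-- **COST THEOREM with the sharp far tail, RH-free.** `HandoffDodgerCostTheorem.dodger_cost_le` verbatim with `c = 4∫_0^{T′} tD ≥ 4e¹⁶`
and the far bracket of `cost_sum_le_ft`: for EVERY `U`,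
`Σᶠ_{ρ ∈ weilZeroIndex U} m(ρ)‖Ĝ(ρ)‖² ≤ 2·A·[N(2T′)/T′²·e^{4S_n − c/(2T′+1)²} + e^{144p²/(7c)}·(0.1615·log √(c/4) − 0.11)/√(c/4)]`.
[this track, ATTEMPT-16 THEOREM 16.2 cost side; ATTEMPT-18 §3; ATTEMPT-24 §2] -/
theorem dodger_cost_le_ft {b T' δ : ℝ} (hb : 0 < b) (hT'2 : 2 ≤ T') (hK1 : 1 ≤ zetaZeroCount T')
    (hK : π * (zetaZeroCount T') / b ≤ T') {D : ℝ → ℝ} (hD : ContinuousOn D (Set.Icc 0 T'))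
    (hD0 : ∀ t ∈ Set.Icc 0 T', 0 ≤ D t)
    (hΔ : ∀ t ∈ Set.Icc 0 T', (zetaZeroCount t : ℝ) - ((min ⌊b * t / π⌋₊ (zetaZeroCount T') : ℕ) : ℝ) ≤ -D t)
    (hc : 4 * Real.exp 16 ≤ 4 * ∫ t in (0 : ℝ)..T', t * D t) (hδ : 0 ≤ δ) (n : ℕ)
    (hgen : ∀ ρ : ℂ, riemannZeta ρ = 0 → 0 < ρ.im →
      ∀ k ∈ Finset.range (zetaZeroCount T'), dodgerNode ρ - latticeFreq b (k + 1) ≠ 0)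
    (U : ℝ) :
    ∑ᶠ ρ ∈ weilZeroIndex U, (riemannZetaZeroOrder ρ : ℝ) *
        ‖weilMellin (fun x : ℝ =>
            weilConv (cutoffCosPoly b (zetaZeroCount T') (dodgerCoeff b T' (zetaZeroCount T'))) (moll n) (x - δ) -
            weilConv (cutoffCosPoly b (zetaZeroCount T') (dodgerCoeff b T' (zetaZeroCount T'))) (moll n) (x + δ)) ρ‖ ^ 2 ≤
      2 * (4 * (Real.sinh (δ / 2) ^ 2 + 1) * Real.exp 1 *
            ((∏ k ∈ Finset.range (zetaZeroCount T'), (latticeFreq b (k + 1)) ^ 2) /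
              ∏ ρ' ∈ zerosBetween 0 T', ‖dodgerNode ρ'‖ ^ (2 * (riemannZetaZeroOrder ρ').toNat)) ^ 2 *
            (4 * Real.cosh (b / 2) ^ 2 * (1 + b) ^ 2 / b ^ 2) *
          ((zetaZeroCount (2 * T') : ℝ) / T' ^ 2 *
              Real.exp (4 * (b / π * (1 + Real.log ((zetaZeroCount T' - 1 : ℕ) : ℝ))) -
                (4 * ∫ t in (0 : ℝ)..T', t * D t) / (2 * T' + 1) ^ 2) +
            Real.exp (144 * (2 * ((zetaZeroCount T' - 1 : ℕ) : ℝ)) ^ 2 / (7 * (4 * ∫ t in (0 : ℝ)..T', t * D t))) *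
              ((0.1615 * Real.log (Real.sqrt ((4 * ∫ t in (0 : ℝ)..T', t * D t) / 4)) - 0.11) /
                Real.sqrt ((4 * ∫ t in (0 : ℝ)..T', t * D t) / 4)))) := by
  classical
  have hπ := Real.pi_pos
  have hT'0 : 0 ≤ T' := by linarith
  -- nonnegativity of the constants
  have hA : 0 ≤ 4 * (Real.sinh (δ / 2) ^ 2 + 1) * Real.exp 1 *
      ((∏ k ∈ Finset.range (zetaZeroCount T'), (latticeFreq b (k + 1)) ^ 2) /
        ∏ ρ' ∈ zerosBetween 0 T', ‖dodgerNode ρ'‖ ^ (2 * (riemannZetaZeroOrder ρ').toNat)) ^ 2 *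
      (4 * Real.cosh (b / 2) ^ 2 * (1 + b) ^ 2 / b ^ 2) := by positivity
  have htb := farBracket_pos hc
  have hBR : 0 ≤ (zetaZeroCount (2 * T') : ℝ) / T' ^ 2 *
        Real.exp (4 * (b / π * (1 + Real.log ((zetaZeroCount T' - 1 : ℕ) : ℝ))) -
          (4 * ∫ t in (0 : ℝ)..T', t * D t) / (2 * T' + 1) ^ 2) +
      Real.exp (144 * (2 * ((zetaZeroCount T' - 1 : ℕ) : ℝ)) ^ 2 / (7 * (4 * ∫ t in (0 : ℝ)..T', t * D t))) *
        ((0.1615 * Real.log (Real.sqrt ((4 * ∫ t in (0 : ℝ)..T', t * D t) / 4)) - 0.11) /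
          Real.sqrt ((4 * ∫ t in (0 : ℝ)..T', t * D t) / 4)) :=
    add_nonneg (by positivity) (mul_nonneg (Real.exp_pos _).le htb.le)
  refine zeroSum_le_of_upper_le (fun x => im_dodgerWitness b T' n δ x) (mul_nonneg zero_le_two (mul_nonneg hA hBR))
    (fun V hV => ?_) U
  rw [mul_div_cancel_left₀ _ two_ne_zero]
  -- the killed zeros contribute nothing
  rw [← Finset.sum_filter_of_ne (p := fun ρ : ℂ => T' < ρ.im) ?kill]
  case kill =>
    intro ρ hρ hne
    refine not_le.1 fun hle => hne ?_
    obtain ⟨hz, h0, h1, him, -⟩ := mem_zerosBetween_zero hρ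
    have hρT : ρ ∈ zerosBetween 0 T' := (mem_zerosBetween le_rfl).2 ⟨hz, h0, h1, him, hle⟩
    rw [weilMellin_witness_zero_of_killed hb n hρT (hgen ρ hz him), norm_zero, zero_pow two_ne_zero, mul_zero]
  -- the lattice-gap sums `S(γ)`
  have hSn : ∀ γ : ℝ, T' < γ → γ ≤ 2 * T' →
      ∑ k ∈ Finset.range (zetaZeroCount T' - 1), 1 / (γ - latticeFreq b (k + 1)) ≤
        b / π * (1 + Real.log ((zetaZeroCount T' - 1 : ℕ) : ℝ)) := by
    intro γ h1 _
    exact sum_inv_lattice_gap_le_log hb (hK.trans h1.le)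
  have hSf : ∀ γ : ℝ, 2 * T' < γ →
      ∑ k ∈ Finset.range (zetaZeroCount T' - 1), 1 / (γ - latticeFreq b (k + 1)) ≤
        2 * ((zetaZeroCount T' - 1 : ℕ) : ℝ) / γ := by
    intro γ hγ
    have hK' : π * ((zetaZeroCount T' - 1 : ℕ) : ℝ) / b ≤ T' := by
      refine le_trans ?_ hK
      have : ((zetaZeroCount T' - 1 : ℕ) : ℝ) ≤ (zetaZeroCount T' : ℝ) := by exact_mod_cast Nat.sub_le _ 1
      exact div_le_div_of_nonneg_right (mul_le_mul_of_nonneg_left this hπ.le) hb.le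
    have hγ0 : 0 < γ := by linarith
    refine (sum_inv_lattice_gap_le_div hb (by linarith)).trans ?_
    rw [mul_one_div, div_le_div_iff₀ (by linarith) hγ0]
    nlinarith [mul_nonneg (Nat.cast_nonneg (α := ℝ) (zetaZeroCount T' - 1))
      (by linarith : (0 : ℝ) ≤ γ - 2 * (π * ((zetaZeroCount T' - 1 : ℕ) : ℝ) / b))]
  -- termwise bound, then `cost_sum_le_ft`
  refine (Finset.sum_le_sum fun ρ hρ => ?_).trans
    (cost_sum_le_ft (S := fun γ : ℝ => ∑ k ∈ Finset.range (zetaZeroCount T' - 1), 1 / (γ - latticeFreq b (k + 1)))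
      hT'2 hc hA hSn hSf _ fun ρ hρ => ?_)
  · rw [Finset.mem_filter] at hρ
    obtain ⟨hz, h0, h1, him, -⟩ := mem_zerosBetween_zero hρ.1
    have hlt : T' < ρ.im := hρ.2
    have hγ1 : 1 ≤ ρ.im := by linarith
    have hm0 : (0 : ℝ) ≤ riemannZetaZeroOrder ρ := zeroOrder_nonneg_of_mem_zerosBetween le_rfl hρ.1
    have hG := normSq_weilMellin_witness_le (b := b) (T' := T') n hδ h0 h1 (ρ := ρ)
    have hF := normSq_weilMellin_dodger_unkilled_le hb hT'0 hK1 hK hD hD0 hΔ h0 h1 hlt hγ1 (hgen ρ hz him)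
    refine mul_le_mul_of_nonneg_left (hG.trans ?_) hm0
    have h4 : 0 ≤ 4 * (Real.sinh (δ / 2) ^ 2 + 1) * Real.exp 1 := by positivity
    refine (mul_le_mul_of_nonneg_left hF h4).trans (le_of_eq ?_)
    have hE : Real.exp (-(4 / (ρ.im + 1) ^ 2 * ∫ t in (0 : ℝ)..T', t * D t)) =
        Real.exp (-(4 * ∫ t in (0 : ℝ)..T', t * D t) / (ρ.im + 1) ^ 2) := by
      congr 1; ring
    rw [hE]
    ring
  · rw [Finset.mem_filter] at hρ
    obtain ⟨hz, h0, h1, -, -⟩ := mem_zerosBetween_zero hρ.1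
    exact ⟨hz, h0, h1, hρ.2⟩

end Summit.RiemannHypothesis.RiemannHypothesis.Theorems.Handoff

end
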